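/-
Copyright (c) 2026 the pub-hodgecm-mathlib formalisation cell (harness21).  Prover seat hodgecm-mathlib-F0P2-p06 (g10): road «S3-tree» (LEAD F0P3a-plan (g11), architect
A-p16 (g29) rulings A-66 (3) ∕ A-67 (1)(t2) ∕ A-71 (β′): S-a3 §3 = the transport of the type-two fixed-neighbour lemma to an arbitrary frame), brick S-a3 §3 FILE (i); 2026-09-01.
-/
import Literature.NumberTheory.Automorphic.UnitaryLatticeTreeDefs          -- ★ T1a (B-p14 (g35)): `latt`, `mapGL`, `IsVertexLattice σ ϖ H d`, `IsSelfDualLattice`, `IsVertex`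
import Literature.NumberTheory.Automorphic.UnitaryGroupFormTransport       -- ★ `formCongr σ T H = (σT)ᵀ H T`, `conj_mem_unitaryGroupOfForm_iff`
import Mathlib.LinearAlgebra.Matrix.Charpoly.Basic                         -- `Matrix.charpoly_units_conj`
import HarnessLib

/-!
# The lattice graph of a hermitian space — FRAME CHANGE: the lattice tree of `(K^N, (σT)ᵀ H T)` is the `T`-translate of the lattice tree of `(K^N, H)`, and the
# type-two fixed-neighbour lemma (S-a3) transports along it (Bruhat–Tits 1972 §10; Platonov–Rapinchuk §2.3)

Topic `NumberTheory/Automorphic`; namespace `Literature.NumberTheory.Automorphic.UnitaryLatticeTree`.  THEOREMS ONLY (no definition, no instance, no notation, no named fact,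
no `sorry`); kernel lane.  Cell `pub/hodgecm-mathlib` (D-0151), crux H413 = `stmt-HodgeConjecture-24833`; road «S3-tree», the «SPAN-0» critical path (architect A-66): S-a3
«a residually unipotent element of a type-two vertex stabiliser fixes a self-dual neighbour» is proved at the standard frame `J₀ = antidiag(1,1,1)` (F0P3a-p07 (g11),
`UnitaryLatticeTreeTypeTwoUnipotentFixedNeighbour`); THIS FILE is its §3 (i) (A-67 (1)(t2), dealt to F0P2-p06 (g10) by A-71 (β′)): the GENERIC FRAME CHANGE that carries it —
and every statement of T1a's currency — from `H` to the congruent form `formCongr σ T H = (σT)ᵀ H T` (`T ∈ GL_N(K)` arbitrary, NOT assumed integral).  The CM dress at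
`placeForm H′ w.1` (★ `exists_glInt_placeForm_eq_formCongr_antidiagonal_of_isUnramifiedIn`: `H′_w = formCongr σ_w T J₀` under good reduction) is FILE (ii).
HONEST LABEL: HC_CM is proved only modulo the 2 remaining named inputs (hLiu418 24832, h413 24833) until rung 0 closes; nothing printed is asserted here (elementary lattice
algebra over a valuation ring); S3 (`stub_N6nsS3id`) stays a print row until the road's END lands.

THE MATHEMATICS.  `Gram_{(σT)ᵀHT}(g) = (σg)ᵀ(σT)ᵀ H T g = Gram_H(Tg)` (`formCongr_formCongr`), so **`M` is a vertex of type `d` for `(σT)ᵀ H T` iff `T·M` is a vertex of type `d`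
for `H`** (`isVertexLattice_formCongr_iff`; in particular self-dual ↔ self-dual, vertex ↔ vertex); on groups, `g ∈ U(σ, (σT)ᵀHT) ↔ TgT⁻¹ ∈ U(σ, H)` (★
`conj_mem_unitaryGroupOfForm_iff`), with `(TgT⁻¹)·(T·M) = T·M ↔ g·M = M` (`mapGL_conj_mapGL_eq_iff`) and `charpoly(TgT⁻¹) = charpoly g` (`Matrix.charpoly_units_conj`).  Hence
(§2) **the S-a3 statement at `J₀` implies the S-a3 statement at every congruent form `(σT)ᵀ J₀ T`**: `exists_isSelfDualLattice_gt_mapGL_eq_of_charpoly_formCongr` takes the `J₀`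
statement as the hypothesis `hSa3` (its binder text = F0P3a-p07's head `exists_isSelfDualLattice_gt_mapGL_eq_of_charpoly` after `(hd) (htr₂)`, so the discharge is one token
when that head is ★) and returns the same conclusion for `formCongr σ T J₀` (δ ↦ TδT⁻¹, N ↦ T·N, M′ ↦ T⁻¹·M′; strict containment transports by ★ `mapGL_lt_mapGL_iff`).

* §1 `formCongr_formCongr`, **`isVertexLattice_formCongr_iff`**, `isSelfDualLattice_formCongr_iff`, `isVertex_formCongr_iff`, `mapGL_inv_mapGL`, `mapGL_mapGL_inv`,
  **`mapGL_conj_mapGL_eq_iff`**, `charpoly_coe_conj`.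
* §2 **`exists_isSelfDualLattice_gt_mapGL_eq_of_charpoly_formCongr`** (S-a3 transported to `(σT)ᵀ J₀ T`, modulo the `J₀` statement `hSa3`).
* §3 `isVertexLattice_congr_of_v_eq` ∕ `isSelfDualLattice_congr_of_v_eq` (the vertex predicates see `ϖ` only through `|ϖ|`), `charpoly_coeff_eq_charpoly_one_coeff_of_three_le`,
  **`forall_v_charpoly_sub_lt_one_of_lt_three`** («SPAN-0»'s `i < 3` token ⇒ S-a3's all-`i` token; the `≤ 1` integrality token is ★ `v_charpoly_coeff_le_one_of_residuallyUnipotent`).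

## References
* [BruhatTits1972] F. Bruhat, J. Tits, *Groupes réductifs sur un corps local I*, Publ. Math. IHÉS 41 (1972), §10 (lattice models of the building; change of frame).
* [PlatonovRapinchuk1994] V. Platonov, A. Rapinchuk, *Algebraic Groups and Number Theory* (1994), §2.3 (congruent forms have conjugate unitary groups).
* [Serre1980Trees] J.-P. Serre, *Trees* (1980), Ch. II §1.1.
-/

set_option autoImplicit false

noncomputable section

open scoped Valued WithZero Matrix MatrixGroups

namespace Literature.NumberTheory.Automorphic.UnitaryLatticeTree

open Literature.NumberTheory.Automorphic Literature.NumberTheory.Automorphic.HermitianLattice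

variable {K : Type*} [Field K] [Valued K ℤᵐ⁰] {σ : K →+* K} {ϖ : K} {N : ℕ}

/-! ## §1 Frame change for vertices and for the action -/

omit [Valued K ℤᵐ⁰] in
/-- `Gram_{(σT)ᵀHT}(g) = Gram_H(Tg)`: `formCongr σ g (formCongr σ T H) = formCongr σ (T g) H`. [cite: PlatonovRapinchuk1994, §2.3] -/
theorem formCongr_formCongr (T g : GL (Fin N) K) (H : Matrix (Fin N) (Fin N) K) : formCongr σ g (formCongr σ T H) = formCongr σ (T * g) H := by
  simp only [formCongr, Units.val_mul, Matrix.map_mul, Matrix.transpose_mul, Matrix.mul_assoc]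

/-- **FRAME CHANGE FOR VERTICES**: `M` is a vertex of type `d` for the congruent form `(σT)ᵀ H T` iff `T·M` is a vertex of type `d` for `H`.
[cite: BruhatTits1972, §10] [cite: PlatonovRapinchuk1994, §2.3] -/
theorem isVertexLattice_formCongr_iff (T : GL (Fin N) K) (H : Matrix (Fin N) (Fin N) K) (d : ℕ) (M : Submodule 𝒪[K] (Fin N → K)) :
    IsVertexLattice σ ϖ (formCongr σ T H) d M ↔ IsVertexLattice σ ϖ H d (mapGL T M) := by
  constructor
  · rintro ⟨g, rfl, hG, hG', hdet⟩
    exact ⟨T * g, mapGL_latt T g, by rwa [← formCongr_formCongr], by rwa [← formCongr_formCongr], by rwa [← formCongr_formCongr]⟩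
  · rintro ⟨g, hMg, hG, hG', hdet⟩
    have hM : M = latt (((T⁻¹ * g : GL (Fin N) K)) : Matrix (Fin N) (Fin N) K) := by
      rw [← mapGL_latt, ← hMg, ← mapGL_mul, inv_mul_cancel, mapGL_one]
    refine ⟨T⁻¹ * g, hM, ?_, ?_, ?_⟩ <;> rw [formCongr_formCongr, ← mul_assoc, mul_inv_cancel, one_mul]
    exacts [hG, hG', hdet]

/-- Frame change for self-dual lattices. [cite: BruhatTits1972, §10] -/
theorem isSelfDualLattice_formCongr_iff (T : GL (Fin N) K) (H : Matrix (Fin N) (Fin N) K) (M : Submodule 𝒪[K] (Fin N → K)) :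
    IsSelfDualLattice σ ϖ (formCongr σ T H) M ↔ IsSelfDualLattice σ ϖ H (mapGL T M) :=
  isVertexLattice_formCongr_iff T H 0 M

/-- Frame change for vertices of unspecified type. [cite: BruhatTits1972, §10] -/
theorem isVertex_formCongr_iff (T : GL (Fin N) K) (H : Matrix (Fin N) (Fin N) K) (M : Submodule 𝒪[K] (Fin N → K)) :
    IsVertex σ ϖ (formCongr σ T H) M ↔ IsVertex σ ϖ H (mapGL T M) :=
  exists_congr fun d => isVertexLattice_formCongr_iff T H d M

/-- `T⁻¹·(T·M) = M`. [cite: Serre1980Trees, II.1.1] -/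
theorem mapGL_inv_mapGL (T : GL (Fin N) K) (M : Submodule 𝒪[K] (Fin N → K)) : mapGL T⁻¹ (mapGL T M) = M := by
  rw [← mapGL_mul, inv_mul_cancel, mapGL_one]

/-- `T·(T⁻¹·M) = M`. [cite: Serre1980Trees, II.1.1] -/
theorem mapGL_mapGL_inv (T : GL (Fin N) K) (M : Submodule 𝒪[K] (Fin N → K)) : mapGL T (mapGL T⁻¹ M) = M := by
  rw [← mapGL_mul, mul_inv_cancel, mapGL_one]

/-- **FRAME CHANGE FOR THE ACTION**: `(T g T⁻¹)·(T·M) = T·M ↔ g·M = M`. [cite: BruhatTits1972, §10] [cite: PlatonovRapinchuk1994, §2.3] -/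
theorem mapGL_conj_mapGL_eq_iff (T g : GL (Fin N) K) (M : Submodule 𝒪[K] (Fin N → K)) :
    mapGL (T * g * T⁻¹) (mapGL T M) = mapGL T M ↔ mapGL g M = M := by
  rw [mapGL_mul, mapGL_mul, mapGL_inv_mapGL]
  exact ⟨fun h => by simpa only [mapGL_inv_mapGL] using congrArg (mapGL T⁻¹) h, fun h => by rw [h]⟩

omit [Valued K ℤᵐ⁰] in
/-- `charpoly (T g T⁻¹) = charpoly g` on the underlying matrices. [cite: PlatonovRapinchuk1994, §2.3] -/
theorem charpoly_coe_conj (T g : GL (Fin N) K) :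
    (((T * g * T⁻¹ : GL (Fin N) K)) : Matrix (Fin N) (Fin N) K).charpoly = (g : Matrix (Fin N) (Fin N) K).charpoly := by
  rw [Units.val_mul, Units.val_mul, Matrix.coe_units_inv]
  exact Matrix.charpoly_units_conj T _

/-! ## §2 S-a3 transported to a congruent frame `(σT)ᵀ J₀ T` -/

/-- **S-a3 AT EVERY FRAME CONGRUENT TO `J₀`** (modulo the `J₀` statement `hSa3` = F0P3a-p07's head `exists_isSelfDualLattice_gt_mapGL_eq_of_charpoly` after its datum binders):
for `T ∈ GL₃(K)` and the form `H = (σT)ᵀ J₀ T`, every `δ ∈ U(σ, H)` whose characteristic polynomial is coefficientwise congruent to `charpoly 1 = (X − 1)³` and which fixes a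
type-two vertex `N` of the `H`-tree fixes a SELF-DUAL vertex `M` with `N < M`.  (Transport: `TδT⁻¹ ∈ U(σ, J₀)` has the same characteristic polynomial and fixes the
type-two `J₀`-vertex `T·N`; pull the `J₀`-neighbour back by `T⁻¹`.) [cite: BruhatTits1972, §10] [cite: PlatonovRapinchuk1994, §2.3] -/
theorem exists_isSelfDualLattice_gt_mapGL_eq_of_charpoly_formCongr (T : GL (Fin 3) K)
    (hSa3 : ∀ (δ : GL (Fin 3) K), δ ∈ unitaryGroupOfForm σ ((StdForm.antidiagonal 3).over K) →
      (∀ i, Valued.v ((δ : Matrix (Fin 3) (Fin 3) K).charpoly.coeff i - (1 : Matrix (Fin 3) (Fin 3) K).charpoly.coeff i) < 1) →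
      ∀ (N : Submodule 𝒪[K] (Fin 3 → K)), IsVertexLattice σ ϖ ((StdForm.antidiagonal 3).over K) 2 N → mapGL δ N = N →
        ∃ M : Submodule 𝒪[K] (Fin 3 → K), IsSelfDualLattice σ ϖ ((StdForm.antidiagonal 3).over K) M ∧ N < M ∧ mapGL δ M = M)
    {δ : GL (Fin 3) K} (hδ : δ ∈ unitaryGroupOfForm σ (formCongr σ T ((StdForm.antidiagonal 3).over K)))
    (hδ1 : ∀ i, Valued.v ((δ : Matrix (Fin 3) (Fin 3) K).charpoly.coeff i - (1 : Matrix (Fin 3) (Fin 3) K).charpoly.coeff i) < 1)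
    {N : Submodule 𝒪[K] (Fin 3 → K)} (hN : IsVertexLattice σ ϖ (formCongr σ T ((StdForm.antidiagonal 3).over K)) 2 N) (hδN : mapGL δ N = N) :
    ∃ M : Submodule 𝒪[K] (Fin 3 → K), IsSelfDualLattice σ ϖ (formCongr σ T ((StdForm.antidiagonal 3).over K)) M ∧ N < M ∧ mapGL δ M = M := by
  -- transport to `J₀`
  have hδ' : T * δ * T⁻¹ ∈ unitaryGroupOfForm σ ((StdForm.antidiagonal 3).over K) := conj_mem_unitaryGroupOfForm σ T _ hδ
  have hδ1' : ∀ i, Valued.v (((T * δ * T⁻¹ : GL (Fin 3) K) : Matrix (Fin 3) (Fin 3) K).charpoly.coeff i - (1 : Matrix (Fin 3) (Fin 3) K).charpoly.coeff i) < 1 := by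
    rw [charpoly_coe_conj]; exact hδ1
  have hN' : IsVertexLattice σ ϖ ((StdForm.antidiagonal 3).over K) 2 (mapGL T N) := (isVertexLattice_formCongr_iff T _ 2 N).1 hN
  have hδN' : mapGL (T * δ * T⁻¹) (mapGL T N) = mapGL T N := (mapGL_conj_mapGL_eq_iff T δ N).2 hδN
  obtain ⟨M', hM', hlt, hfix⟩ := hSa3 _ hδ' hδ1' _ hN' hδN'
  -- pull back by `T⁻¹`
  refine ⟨mapGL T⁻¹ M', ?_, ?_, ?_⟩
  · rw [isSelfDualLattice_formCongr_iff, mapGL_mapGL_inv]; exact hM'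
  · rw [← mapGL_lt_mapGL_iff T, mapGL_mapGL_inv]; exact hlt
  · rw [← mapGL_conj_mapGL_eq_iff T, mapGL_mapGL_inv]; exact hfix


/-! ## §3 Two bookkeeping bridges for the «SPAN-0» assembly: uniformiser-independence of the vertex types; the `i < 3` charpoly token ⇒ the all-`i` token -/

/-- **The vertex predicates depend on the uniformiser only through its valuation**: `IsVertexLattice σ ϖ H d M ↔ IsVertexLattice σ ϖ′ H d M` when `|ϖ| = |ϖ′|`
(the conditions are `G`, `ϖ·G⁻¹` integral and `|det G| = |ϖ|^d`). [cite: BruhatTits1972, §10] -/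
theorem isVertexLattice_congr_of_v_eq {ϖ ϖ' : K} (h : Valued.v ϖ = Valued.v ϖ') (H : Matrix (Fin N) (Fin N) K) (d : ℕ) (M : Submodule 𝒪[K] (Fin N → K)) :
    IsVertexLattice σ ϖ H d M ↔ IsVertexLattice σ ϖ' H d M := by
  have key : ∀ {a b : K}, Valued.v a = Valued.v b → ∀ (G : Matrix (Fin N) (Fin N) K), IsIntMatrix (a • G⁻¹) → IsIntMatrix (b • G⁻¹) := by
    intro a b hab G hG i j
    have := hG i j
    rw [Matrix.smul_apply, smul_eq_mul, map_mul] at this ⊢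
    rwa [← hab]
  constructor
  · rintro ⟨g, hM, hG, hG', hdet⟩; exact ⟨g, hM, hG, key h _ hG', by rw [← h]; exact hdet⟩
  · rintro ⟨g, hM, hG, hG', hdet⟩; exact ⟨g, hM, hG, key h.symm _ hG', by rw [h]; exact hdet⟩

/-- Same for self-dual lattices. [cite: BruhatTits1972, §10] -/
theorem isSelfDualLattice_congr_of_v_eq {ϖ ϖ' : K} (h : Valued.v ϖ = Valued.v ϖ') (H : Matrix (Fin N) (Fin N) K) (M : Submodule 𝒪[K] (Fin N → K)) :
    IsSelfDualLattice σ ϖ H M ↔ IsSelfDualLattice σ ϖ' H M :=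
  isVertexLattice_congr_of_v_eq h H 0 M

omit [Valued K ℤᵐ⁰] in
/-- Beyond degree `2` the characteristic polynomials of `A ∈ M₃(K)` and of `1` have the same coefficients (both monic cubics). [cite: PlatonovRapinchuk1994, §2.3] -/
theorem charpoly_coeff_eq_charpoly_one_coeff_of_three_le (A : Matrix (Fin 3) (Fin 3) K) {i : ℕ} (hi : 3 ≤ i) :
    A.charpoly.coeff i = (1 : Matrix (Fin 3) (Fin 3) K).charpoly.coeff i := by
  rcases hi.eq_or_lt with h3 | h4
  · have hA := (Matrix.charpoly_monic A).coeff_natDegree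
    have h1 := (Matrix.charpoly_monic (1 : Matrix (Fin 3) (Fin 3) K)).coeff_natDegree
    rw [Matrix.charpoly_natDegree_eq_dim, Fintype.card_fin] at hA h1
    rw [← h3, hA, h1]
  · rw [Polynomial.coeff_eq_zero_of_natDegree_lt (by rw [Matrix.charpoly_natDegree_eq_dim, Fintype.card_fin]; exact h4),
      Polynomial.coeff_eq_zero_of_natDegree_lt (by rw [Matrix.charpoly_natDegree_eq_dim, Fintype.card_fin]; exact h4)]

/-- **The «SPAN-0» cover token (`i < 3`) implies S-a3's token (all `i`)**: `(∀ i < 3, |coeff_i charpoly A − coeff_i charpoly 1| < 1) → ∀ i, |…| < 1` for `A ∈ M₃(K)`.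
[cite: BruhatTits1972, §10] -/
theorem forall_v_charpoly_sub_lt_one_of_lt_three (A : Matrix (Fin 3) (Fin 3) K)
    (h : ∀ i < 3, Valued.v (A.charpoly.coeff i - (1 : Matrix (Fin 3) (Fin 3) K).charpoly.coeff i) < 1) (i : ℕ) :
    Valued.v (A.charpoly.coeff i - (1 : Matrix (Fin 3) (Fin 3) K).charpoly.coeff i) < 1 := by
  rcases lt_or_ge i 3 with hi | hi
  · exact h i hi
  · rw [charpoly_coeff_eq_charpoly_one_coeff_of_three_le A hi, sub_self, map_zero]; exact zero_lt_one

end Literature.NumberTheory.Automorphic.UnitaryLatticeTree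

end
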